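import Literature.MathematicalPhysics.QuantumLattice.ApproximatingHamiltonianProofs
import HarnessLib

/-!
# Joint concavity of the finite-volume Gibbs free energy in the coupling constants: tangent planes
# with thermal expectations as slopes, Jensen floors, Lipschitz bounds and the Peierls–Bogoliubov
# bracket on thermal expectation values

Topic `Literature/MathematicalPhysics/QuantumLattice` (thermal toolkit; companion of
`ApproximatingHamiltonianProofs.lean`, which has the Peierls–Bogoliubov inequality in logarithmic form
`log Z_β(H) − β Re⟨W⟩_{β,H} ≤ log Z_β(H + W)`, the Lipschitz bound `|log Z_β(H₁) − log Z_β(H₂)| ≤ β‖H₁ − H₂‖`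
and monotonicity in `H`, and of `GibbsPressureTemperature.lean` / `GibbsVariationalPrinciple.lean`, which
treat the dependence on the inverse temperature `β`). Written for the `T > 0` branch of the Hubbard
material-oracle programme (stage S2 (iii) "certificate FAMILIES over parameter BOXES at `T > 0`"; the
phase map's `T × couplings` cells): a thermal certificate is solved at finitely many couplings, the
consumer needs words on whole cells. This file is the positive-temperature twin of the `T = 0` transport
calculus (`HubbardNNNHoppingEnergyDensityRegionBounds`, `HubbardTTPrimeMeanEnergySupergradient`,
`HubbardTTPrimeGrandCanonicalEnergyDensity`): there the ground-state energy is an infimum of affine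
functionals of the couplings, here `−β⁻¹ log tr e^{−βH}` is a concave function of the Hamiltonian.
Everything is PROVED for Hermitian matrices on a nonempty finite index type; no definition, no named
fact, no numerical input. Notation: `Z_β(H) = tr e^{−βH}` (`Matrix.partitionFn`), `⟨A⟩_{β,H} =
tr(e^{−βH}A)/Z_β(H)` (`Matrix.gibbsState`), `F_β(H) = −β⁻¹ log Z_β(H)`.

* §1 MATRIX FORMS. `log_partitionFn_smul_add_smul_le`: for Hermitian `H₁, H₂` and `a, b ≥ 0`, `a + b = 1`,
  `log Z_β(aH₁ + bH₂) ≤ a log Z_β(H₁) + b log Z_β(H₂)` (every real `β`) — convexity of `H ↦ log Z_β(H)`,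
  from two Peierls–Bogoliubov tangents at the barycentre. `mul_re_gibbsState_add_le_log_partitionFn_sub`
  with the tree's tangent gives the two-sided PEIERLS–BOGOLIUBOV BRACKET
  `β Re⟨W⟩_{β,H+W} ≤ log Z_β(H) − log Z_β(H + W) ≤ β Re⟨W⟩_{β,H}` (`log_partitionFn_sub_mem_Icc`), i.e. for
  `β > 0`: `Re⟨W⟩_{β,H+W} ≤ F_β(H + W) − F_β(H) ≤ Re⟨W⟩_{β,H}` (`freeEnergy_sub_mem_Icc`) — Lieb's
  `λ⟨A⟩ ≥ f(λ) − f(0)` read at both ends.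
* §2 AFFINE FAMILIES `x ↦ H(x)` from a real vector space of couplings (hypothesis
  `H(a x + b y) = a H(x) + b H(y)` for `a + b = 1`, all `H(x)` Hermitian): `convexOn_log_partitionFn_affine`
  (`ConvexOn ℝ univ (x ↦ log Z_β(H x))`), `concaveOn_freeEnergy_affine` (`β > 0`); JENSEN FLOORS
  `sum_mul_le_freeEnergy_affine_sum` (certified lower bounds `ℓₖ ≤ F_β(H xₖ)` at corners and convex weights
  give `Σ wₖ ℓₖ ≤ F_β(H(Σ wₖ xₖ))` — every point of the convex hull of certified corners is certified from
  below) and `min_le_freeEnergy_affine_of_mem_segment`; the TANGENT PLANE `freeEnergy_affine_le_tangent`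
  (`F_β(H y) ≤ F_β(H x) + Re⟨H y − H x⟩_{β,H x}` — caps transport from ONE anchor with the anchor's thermal
  expectations as slopes); LIPSCHITZ `abs_freeEnergy_affine_sub_le` (`|F_β(H x) − F_β(H y)| ≤ ‖H x − H y‖`).
* §3 COORDINATE FAMILIES `θ ↦ H₀ + Σₐ θₐ Dₐ` (`θ : ι → ℝ`, finitely many Hermitian coupling directions `Dₐ`):
  they are affine, so §2 applies; the slope form of the tangent plane
  `F_β(θ) ≤ F_β(θ₀) + Σₐ (θₐ − θ₀ₐ) Re⟨Dₐ⟩_{β,θ₀}` (`freeEnergy_coord_le_tangent`) and its certified reading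
  with slope WINDOWS `Re⟨Dₐ⟩_{β,θ₀} ∈ [loₐ, hiₐ]` (`freeEnergy_coord_le_of_slopes_mem_Icc`, sign-split);
  the coordinate Lipschitz bound `|F_β(θ) − F_β(θ')| ≤ Σₐ |θₐ − θ'ₐ| ‖Dₐ‖` (`abs_freeEnergy_coord_sub_le`);
  and the coordinate PEIERLS–BOGOLIUBOV BRACKET on a thermal expectation from free energies at the two
  neighbours `θ ± h eₐ` (`h > 0`): `(F_β(θ + h eₐ) − F_β(θ))/h ≤ Re⟨Dₐ⟩_{β,θ} ≤ (F_β(θ) − F_β(θ − h eₐ))/h`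
  (`freeEnergy_coord_slope_bracket`), with the certified corollary
  `re_gibbsState_coord_mem_Icc_of_bounds` — certified thermal DOUBLE OCCUPANCY / DENSITY / hopping
  energies from certified free-energy bounds at three couplings, the `T > 0` form of Griffiths' brackets.
* The grand-canonical `t–t'` HUBBARD TORUS `hubbardTorusTT' L t t' U − μN` (an affine family in
  `(t, t', U, μ) ∈ ℝ⁴`) is instantiated in the companion file `HubbardTTPrimeTorusFreeEnergyConcavity.lean`
  (joint concavity in all four couplings, four-slope tangent plane, Jensen floors, Lipschitz, thermal
  double-occupancy and particle-number brackets).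

HONEST SCOPE: finite volume only (the thermodynamic limit of the free energy density and its concavity,
Israel's Theorem I.3.4, are not touched); transport lemmas, no certificate, no number, no claim about any
phase. The thermal ENERGY `Re⟨H⟩_β` is not concave in the couplings and is not transported here (its
`β`-chords are `GibbsVariationalPrinciple.chord_le_energy / energy_le_chord`).

## Mathlib / tree search
REUSED: `log_partitionFn_sub_le_log_partitionFn_add` (Peierls–Bogoliubov, log form),
`abs_log_partitionFn_sub_log_partitionFn_le` (Lipschitz), `partitionFn_re_pos`, `isHermitian_real_smul`
(`ApproximatingHamiltonianProofs` / `TraceInequalitiesProofs`); `ConvexOn.map_sum_le`, `ConcaveOn.le_map_sum`,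
`ConcaveOn.min_le_of_mem_segment`, `ConvexOn.smul`, `ConvexOn.neg` from `Mathlib.Analysis.Convex`.
`lean search 'partitionFn.*convex|concave.*partitionFn' --decl` → no declaration: the convexity of
`H ↦ log Z_β(H)` as a `ConvexOn` statement and its multi-parameter consequences are new here.

## References
* E. H. Lieb, *The classical limit of quantum spin systems*, Commun. Math. Phys. 31 (1973) 327–340,
  §V eqs. (5.2)–(5.4) (`λ⟨A⟩ ≥ f(λ) − f(0)`, hence `[f(0) − f(−λ)]/λ ≥ ⟨A⟩ ≥ [f(λ) − f(0)]/λ` for the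
  free energy `f(λ) = −β⁻¹ log tr e^{−β(H + λA)}`). [cite: Lieb1973, §V (5.2)–(5.4)]
* R. B. Israel, *Convexity in the Theory of Lattice Gases* (1979), §I.3, Theorem I.3.4 (the pressure is
  convex and `1`-Lipschitz in the interaction). [cite: Israel1979, Thm. I.3.4]
* D. Ruelle, *Statistical Mechanics: Rigorous Results* (1969), §2.5 (convexity inequalities for
  `log tr e^{A}`). [cite: Ruelle1969, §2.5]
-/

noncomputable section

open scoped Matrix.Norms.L2Operator ComplexOrder BigOperators
open Matrix Finset

namespace Literature.MathematicalPhysics.QuantumLattice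

variable {n : Type*} [Fintype n] [DecidableEq n]

/-! ### §1 Matrix forms: convexity of `log Z` in `H` and the Peierls–Bogoliubov bracket -/

section MatrixForms

variable {H H₁ H₂ W : Matrix n n ℂ}

/-- Linearity of the Gibbs state over REAL scalars, real parts:
`Re⟨(a:ℂ)•X + (b:ℂ)•Y⟩ = a Re⟨X⟩ + b Re⟨Y⟩`. [folklore] -/
private theorem re_gibbsState_smul_add_smul (β : ℝ) (H X Y : Matrix n n ℂ) (a b : ℝ) :
    (gibbsState β H ((a : ℂ) • X + (b : ℂ) • Y)).re =
      a * (gibbsState β H X).re + b * (gibbsState β H Y).re := by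
  rw [map_add, map_smul, map_smul, smul_eq_mul, smul_eq_mul, Complex.add_re, Complex.re_ofReal_mul,
    Complex.re_ofReal_mul]

/-- **Convexity of `H ↦ log Z_β(H)` on Hermitian matrices** (two-point form, every real `β`): for
`a, b ≥ 0` with `a + b = 1`, `log Z_β(aH₁ + bH₂) ≤ a log Z_β(H₁) + b log Z_β(H₂)`. Proof: the two
Peierls–Bogoliubov tangents at the barycentre `H_b = aH₁ + bH₂`, weighted by `a` and `b`, add up to a
tangent along `a(H₁ − H_b) + b(H₂ − H_b) = 0`. [cite: Israel1979, Thm. I.3.4] -/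
theorem log_partitionFn_smul_add_smul_le (hH₁ : H₁.IsHermitian) (hH₂ : H₂.IsHermitian) [Nonempty n]
    (β : ℝ) {a b : ℝ} (ha : 0 ≤ a) (hb : 0 ≤ b) (hab : a + b = 1) :
    Real.log (partitionFn β ((a : ℂ) • H₁ + (b : ℂ) • H₂)).re ≤
      a * Real.log (partitionFn β H₁).re + b * Real.log (partitionFn β H₂).re := by
  set Hb : Matrix n n ℂ := (a : ℂ) • H₁ + (b : ℂ) • H₂ with hHb_def
  have hHb : Hb.IsHermitian := (isHermitian_real_smul hH₁ a).add (isHermitian_real_smul hH₂ b)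
  have h1 := log_partitionFn_sub_le_log_partitionFn_add hHb (hH₁.sub hHb) β
  have h2 := log_partitionFn_sub_le_log_partitionFn_add hHb (hH₂.sub hHb) β
  rw [add_sub_cancel] at h1 h2
  have hmat : (a : ℂ) • (H₁ - Hb) + (b : ℂ) • (H₂ - Hb) = 0 := by
    have hab' : (a : ℂ) + (b : ℂ) = 1 := by rw [← Complex.ofReal_add, hab, Complex.ofReal_one]
    rw [smul_sub, smul_sub, sub_add_sub_comm, ← add_smul, hab', one_smul, hHb_def, sub_self]
  have hcomb : a * (gibbsState β Hb (H₁ - Hb)).re + b * (gibbsState β Hb (H₂ - Hb)).re = 0 := by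
    rw [← re_gibbsState_smul_add_smul, hmat, map_zero, Complex.zero_re]
  have e1 : a * Real.log (partitionFn β Hb).re + b * Real.log (partitionFn β Hb).re =
      Real.log (partitionFn β Hb).re := by rw [← add_mul, hab, one_mul]
  have e2 : β * (a * (gibbsState β Hb (H₁ - Hb)).re) + β * (b * (gibbsState β Hb (H₂ - Hb)).re) = 0 := by
    rw [← mul_add, hcomb, mul_zero]
  have i1 := mul_le_mul_of_nonneg_left h1 ha
  have i2 := mul_le_mul_of_nonneg_left h2 hb
  rw [mul_sub] at i1 i2
  linarith

/-- **The lower Peierls–Bogoliubov tangent**: `β Re⟨W⟩_{β,H+W} ≤ log Z_β(H) − log Z_β(H + W)` (the tree's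
`log_partitionFn_sub_le_log_partitionFn_add` applied at `H + W` with the perturbation `−W`).
[cite: Lieb1973, §V (5.2)–(5.4)] -/
theorem mul_re_gibbsState_add_le_log_partitionFn_sub (hH : H.IsHermitian) (hW : W.IsHermitian)
    [Nonempty n] (β : ℝ) :
    β * (gibbsState β (H + W) W).re ≤
      Real.log (partitionFn β H).re - Real.log (partitionFn β (H + W)).re := by
  have h := log_partitionFn_sub_le_log_partitionFn_add (hH.add hW) hW.neg β
  rw [add_neg_cancel_right, map_neg, Complex.neg_re] at h
  linarith

/-- **The upper Peierls–Bogoliubov tangent** (the tree's inequality, rearranged):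
`log Z_β(H) − log Z_β(H + W) ≤ β Re⟨W⟩_{β,H}`. [cite: Lieb1973, §V (5.2)–(5.4)] -/
theorem log_partitionFn_sub_le_mul_re_gibbsState (hH : H.IsHermitian) (hW : W.IsHermitian)
    [Nonempty n] (β : ℝ) :
    Real.log (partitionFn β H).re - Real.log (partitionFn β (H + W)).re ≤
      β * (gibbsState β H W).re := by
  have h := log_partitionFn_sub_le_log_partitionFn_add hH hW β
  linarith

/-- **The Peierls–Bogoliubov bracket** (every real `β`):
`log Z_β(H) − log Z_β(H + W) ∈ [β Re⟨W⟩_{β,H+W}, β Re⟨W⟩_{β,H}]` — the free-energy increment lies between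
the expectation of the perturbation in the perturbed and in the unperturbed Gibbs state.
[cite: Lieb1973, §V (5.2)–(5.4)] -/
theorem log_partitionFn_sub_mem_Icc (hH : H.IsHermitian) (hW : W.IsHermitian) [Nonempty n] (β : ℝ) :
    Real.log (partitionFn β H).re - Real.log (partitionFn β (H + W)).re ∈
      Set.Icc (β * (gibbsState β (H + W) W).re) (β * (gibbsState β H W).re) :=
  ⟨mul_re_gibbsState_add_le_log_partitionFn_sub hH hW β,
    log_partitionFn_sub_le_mul_re_gibbsState hH hW β⟩

/-- **Free-energy form of the bracket** (`β > 0`, `F_β = −β⁻¹ log Z_β`):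
`Re⟨W⟩_{β,H+W} ≤ F_β(H + W) − F_β(H) ≤ Re⟨W⟩_{β,H}`. [cite: Lieb1973, §V (5.2)–(5.4)] -/
theorem freeEnergy_sub_mem_Icc (hH : H.IsHermitian) (hW : W.IsHermitian) [Nonempty n] {β : ℝ}
    (hβ : 0 < β) :
    -(β⁻¹ * Real.log (partitionFn β (H + W)).re) - -(β⁻¹ * Real.log (partitionFn β H).re) ∈
      Set.Icc (gibbsState β (H + W) W).re (gibbsState β H W).re := by
  have h1 := mul_re_gibbsState_add_le_log_partitionFn_sub hH hW β
  have h2 := log_partitionFn_sub_le_mul_re_gibbsState hH hW β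
  have hβ' : 0 < β⁻¹ := inv_pos.2 hβ
  constructor
  · have := mul_le_mul_of_nonneg_left h1 hβ'.le
    rw [← mul_assoc, inv_mul_cancel₀ hβ.ne', one_mul, mul_sub] at this
    linarith
  · have := mul_le_mul_of_nonneg_left h2 hβ'.le
    rw [← mul_assoc, inv_mul_cancel₀ hβ.ne', one_mul, mul_sub] at this
    linarith

end MatrixForms

/-! ### §2 Affine families of Hamiltonians over a real vector space of couplings -/

section Family

variable {E : Type*} {H : E → Matrix n n ℂ}

/-- **The tangent plane** (coordinate-free): `F_β(H y) ≤ F_β(H x) + Re⟨H y − H x⟩_{β,H x}` for `β > 0` —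
a certified free-energy CAP transports from ONE anchor `x` with the anchor's thermal expectation of the
coupling increment as slope. [cite: Lieb1973, §V (5.2)–(5.4)] -/
theorem freeEnergy_affine_le_tangent [Nonempty n] (hHh : ∀ x, (H x).IsHermitian) {β : ℝ} (hβ : 0 < β)
    (x y : E) :
    -(β⁻¹ * Real.log (partitionFn β (H y)).re) ≤
      -(β⁻¹ * Real.log (partitionFn β (H x)).re) + (gibbsState β (H x) (H y - H x)).re := by
  have h := (freeEnergy_sub_mem_Icc (hHh x) ((hHh y).sub (hHh x)) hβ).2
  rw [add_sub_cancel] at h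
  linarith

/-- **The lower tangent** (coordinate-free): `F_β(H x) + Re⟨H y − H x⟩_{β,H y} ≤ F_β(H y)` for `β > 0`.
[cite: Lieb1973, §V (5.2)–(5.4)] -/
theorem freeEnergy_affine_ge_tangent [Nonempty n] (hHh : ∀ x, (H x).IsHermitian) {β : ℝ} (hβ : 0 < β)
    (x y : E) :
    -(β⁻¹ * Real.log (partitionFn β (H x)).re) + (gibbsState β (H y) (H y - H x)).re ≤
      -(β⁻¹ * Real.log (partitionFn β (H y)).re) := by
  have h := (freeEnergy_sub_mem_Icc (hHh x) ((hHh y).sub (hHh x)) hβ).1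
  rw [add_sub_cancel] at h
  linarith

/-- **Lipschitz bound**: `|F_β(H x) − F_β(H y)| ≤ ‖H x − H y‖` (operator norm, `β > 0`).
[cite: Israel1979, Thm. I.3.4] -/
theorem abs_freeEnergy_affine_sub_le [Nonempty n] (hHh : ∀ x, (H x).IsHermitian) {β : ℝ} (hβ : 0 < β)
    (x y : E) :
    |-(β⁻¹ * Real.log (partitionFn β (H x)).re) - -(β⁻¹ * Real.log (partitionFn β (H y)).re)| ≤
      ‖H x - H y‖ := by
  have h := abs_log_partitionFn_sub_log_partitionFn_le (hHh x) (hHh y) hβ.le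
  have hβ' : 0 < β⁻¹ := inv_pos.2 hβ
  have heq : -(β⁻¹ * Real.log (partitionFn β (H x)).re) - -(β⁻¹ * Real.log (partitionFn β (H y)).re) =
      -(β⁻¹ * (Real.log (partitionFn β (H x)).re - Real.log (partitionFn β (H y)).re)) := by ring
  rw [heq, abs_neg, abs_mul, abs_of_pos hβ']
  calc β⁻¹ * |Real.log (partitionFn β (H x)).re - Real.log (partitionFn β (H y)).re|
      ≤ β⁻¹ * (β * ‖H x - H y‖) := mul_le_mul_of_nonneg_left h hβ'.le
    _ = ‖H x - H y‖ := by rw [← mul_assoc, inv_mul_cancel₀ hβ.ne', one_mul]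

end Family

section Affine

variable {E : Type*} [AddCommGroup E] [Module ℝ E] {H : E → Matrix n n ℂ}

/-- **`x ↦ log Z_β(H x)` is convex** for an affine Hermitian family (`H(a x + b y) = a H(x) + b H(y)`
whenever `a + b = 1`), every real `β`. [cite: Israel1979, Thm. I.3.4] -/
theorem convexOn_log_partitionFn_affine [Nonempty n]
    (hH : ∀ (x y : E) (a b : ℝ), a + b = 1 → H (a • x + b • y) = (a : ℂ) • H x + (b : ℂ) • H y)
    (hHh : ∀ x, (H x).IsHermitian) (β : ℝ) :
    ConvexOn ℝ Set.univ (fun x => Real.log (partitionFn β (H x)).re) := by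
  refine ⟨convex_univ, fun x _ y _ a b ha hb hab => ?_⟩
  simp only [smul_eq_mul]
  rw [hH x y a b hab]
  exact log_partitionFn_smul_add_smul_le (hHh x) (hHh y) β ha hb hab

/-- **The free energy `x ↦ F_β(H x) = −β⁻¹ log Z_β(H x)` is concave** in the couplings (`β > 0`).
[cite: Israel1979, Thm. I.3.4] -/
theorem concaveOn_freeEnergy_affine [Nonempty n]
    (hH : ∀ (x y : E) (a b : ℝ), a + b = 1 → H (a • x + b • y) = (a : ℂ) • H x + (b : ℂ) • H y)
    (hHh : ∀ x, (H x).IsHermitian) {β : ℝ} (hβ : 0 < β) :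
    ConcaveOn ℝ Set.univ (fun x => -(β⁻¹ * Real.log (partitionFn β (H x)).re)) := by
  have h := (convexOn_log_partitionFn_affine hH hHh β).smul (inv_pos.2 hβ).le
  exact h.neg

/-- **Jensen form of convexity**: `log Z_β(H(Σ wₖ xₖ)) ≤ Σ wₖ log Z_β(H xₖ)` for convex weights.
[cite: Israel1979, Thm. I.3.4] -/
theorem log_partitionFn_affine_sum_le [Nonempty n]
    (hH : ∀ (x y : E) (a b : ℝ), a + b = 1 → H (a • x + b • y) = (a : ℂ) • H x + (b : ℂ) • H y)
    (hHh : ∀ x, (H x).IsHermitian) (β : ℝ) {κ : Type*} (s : Finset κ) (w : κ → ℝ) (x : κ → E)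
    (hw : ∀ k ∈ s, 0 ≤ w k) (hw1 : ∑ k ∈ s, w k = 1) :
    Real.log (partitionFn β (H (∑ k ∈ s, w k • x k))).re ≤
      ∑ k ∈ s, w k * Real.log (partitionFn β (H (x k))).re := by
  have h := (convexOn_log_partitionFn_affine hH hHh β).map_sum_le (p := x) hw hw1
    (fun _ _ => Set.mem_univ _)
  simpa only [smul_eq_mul] using h

/-- **Jensen FLOORS for the free energy** (`β > 0`): certified lower bounds `ℓₖ ≤ F_β(H xₖ)` at corners
`xₖ` and convex weights give `Σ wₖ ℓₖ ≤ F_β(H(Σ wₖ xₖ))` — the barycentre of certified corners is certified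
from below, with no new solve. [cite: Israel1979, Thm. I.3.4] -/
theorem sum_mul_le_freeEnergy_affine_sum [Nonempty n]
    (hH : ∀ (x y : E) (a b : ℝ), a + b = 1 → H (a • x + b • y) = (a : ℂ) • H x + (b : ℂ) • H y)
    (hHh : ∀ x, (H x).IsHermitian) {β : ℝ} (hβ : 0 < β) {κ : Type*} (s : Finset κ) (w : κ → ℝ)
    (x : κ → E) (ℓ : κ → ℝ) (hw : ∀ k ∈ s, 0 ≤ w k) (hw1 : ∑ k ∈ s, w k = 1)
    (hℓ : ∀ k ∈ s, ℓ k ≤ -(β⁻¹ * Real.log (partitionFn β (H (x k))).re)) :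
    ∑ k ∈ s, w k * ℓ k ≤ -(β⁻¹ * Real.log (partitionFn β (H (∑ k ∈ s, w k • x k))).re) := by
  have h := (concaveOn_freeEnergy_affine hH hHh hβ).le_map_sum (p := x) hw hw1
    (fun _ _ => Set.mem_univ _)
  simp only [smul_eq_mul] at h
  exact (Finset.sum_le_sum fun k hk => mul_le_mul_of_nonneg_left (hℓ k hk) (hw k hk)).trans h

/-- **Segment form**: on the segment between two couplings the free energy is at least the smaller
endpoint value (`β > 0`). [cite: Israel1979, Thm. I.3.4] -/
theorem min_le_freeEnergy_affine_of_mem_segment [Nonempty n]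
    (hH : ∀ (x y : E) (a b : ℝ), a + b = 1 → H (a • x + b • y) = (a : ℂ) • H x + (b : ℂ) • H y)
    (hHh : ∀ x, (H x).IsHermitian) {β : ℝ} (hβ : 0 < β) {x y z : E} (hz : z ∈ segment ℝ x y) :
    min (-(β⁻¹ * Real.log (partitionFn β (H x)).re)) (-(β⁻¹ * Real.log (partitionFn β (H y)).re)) ≤
      -(β⁻¹ * Real.log (partitionFn β (H z)).re) :=
  (concaveOn_freeEnergy_affine hH hHh hβ).min_le_of_mem_segment (Set.mem_univ x) (Set.mem_univ y) hz

end Affine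

/-! ### §3 Coordinate families `θ ↦ H₀ + Σₐ θₐ Dₐ` -/

section Coord

variable {ι : Type*} [Fintype ι] {H₀ : Matrix n n ℂ} {D : ι → Matrix n n ℂ}

omit [Fintype n] [DecidableEq n] in
/-- A coordinate family is Hermitian when its constant part and its coupling directions are.
[folklore] -/
private theorem isHermitian_affineFamily (hH₀ : H₀.IsHermitian) (hD : ∀ a, (D a).IsHermitian) (θ : ι → ℝ) :
    (H₀ + ∑ a, ((θ a : ℝ) : ℂ) • D a).IsHermitian := by
  refine hH₀.add ?_
  have : (∑ a, ((θ a : ℝ) : ℂ) • D a).IsHermitian := by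
    unfold Matrix.IsHermitian
    rw [conjTranspose_sum]
    exact Finset.sum_congr rfl fun a _ => (isHermitian_real_smul (hD a) (θ a)).eq
  exact this

omit [Fintype n] [DecidableEq n] in
/-- **Coordinate families are affine**: `H(aθ + bθ') = a H(θ) + b H(θ')` for `a + b = 1`. [folklore] -/
private theorem affineFamily_smul_add_smul (H₀ : Matrix n n ℂ) (D : ι → Matrix n n ℂ) (θ θ' : ι → ℝ) (a b : ℝ)
    (hab : a + b = 1) :
    H₀ + ∑ c, (((a • θ + b • θ') c : ℝ) : ℂ) • D c =
      (a : ℂ) • (H₀ + ∑ c, ((θ c : ℝ) : ℂ) • D c) + (b : ℂ) • (H₀ + ∑ c, ((θ' c : ℝ) : ℂ) • D c) := by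
  have hab' : (a : ℂ) + (b : ℂ) = 1 := by rw [← Complex.ofReal_add, hab, Complex.ofReal_one]
  have hH₀ : (a : ℂ) • H₀ + (b : ℂ) • H₀ = H₀ := by rw [← add_smul, hab', one_smul]
  have hsum : ∑ c, (((a • θ + b • θ') c : ℝ) : ℂ) • D c =
      (a : ℂ) • ∑ c, ((θ c : ℝ) : ℂ) • D c + (b : ℂ) • ∑ c, ((θ' c : ℝ) : ℂ) • D c := by
    rw [Finset.smul_sum, Finset.smul_sum, ← Finset.sum_add_distrib]
    refine Finset.sum_congr rfl fun c _ => ?_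
    simp only [Pi.add_apply, Pi.smul_apply, smul_eq_mul, Complex.ofReal_add, Complex.ofReal_mul,
      add_smul, mul_smul]
  rw [hsum, smul_add, smul_add,
    add_add_add_comm ((a : ℂ) • H₀) ((a : ℂ) • ∑ c, ((θ c : ℝ) : ℂ) • D c) ((b : ℂ) • H₀)
      ((b : ℂ) • ∑ c, ((θ' c : ℝ) : ℂ) • D c), hH₀]

omit [Fintype n] [DecidableEq n] in
/-- **The increment of a coordinate family** is the combination of the directions:
`H(θ) − H(θ₀) = Σₐ (θₐ − θ₀ₐ) Dₐ`. [folklore] -/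
private theorem affineFamily_sub (H₀ : Matrix n n ℂ) (D : ι → Matrix n n ℂ) (θ θ₀ : ι → ℝ) :
    (H₀ + ∑ a, ((θ a : ℝ) : ℂ) • D a) - (H₀ + ∑ a, ((θ₀ a : ℝ) : ℂ) • D a) =
      ∑ a, (((θ a - θ₀ a : ℝ)) : ℂ) • D a := by
  simp only [Complex.ofReal_sub, sub_smul, Finset.sum_sub_distrib]
  abel

/-- The Gibbs expectation of a real combination of directions, real part:
`Re⟨Σₐ cₐ Dₐ⟩ = Σₐ cₐ Re⟨Dₐ⟩`. [folklore] -/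
private theorem re_gibbsState_sum_real_smul (β : ℝ) (H : Matrix n n ℂ) (D : ι → Matrix n n ℂ) (c : ι → ℝ) :
    (gibbsState β H (∑ a, ((c a : ℝ) : ℂ) • D a)).re = ∑ a, c a * (gibbsState β H (D a)).re := by
  rw [map_sum, Complex.re_sum]
  exact Finset.sum_congr rfl fun a _ => by rw [map_smul, smul_eq_mul, Complex.re_ofReal_mul]

/-- **Joint concavity of the free energy in the coordinates** `θ = (θₐ)ₐ` (`β > 0`).
[cite: Israel1979, Thm. I.3.4] -/
theorem concaveOn_freeEnergy_coord [Nonempty n] (hH₀ : H₀.IsHermitian) (hD : ∀ a, (D a).IsHermitian)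
    {β : ℝ} (hβ : 0 < β) :
    ConcaveOn ℝ Set.univ
      (fun θ : ι → ℝ => -(β⁻¹ * Real.log (partitionFn β (H₀ + ∑ a, ((θ a : ℝ) : ℂ) • D a)).re)) :=
  concaveOn_freeEnergy_affine (H := fun θ : ι → ℝ => H₀ + ∑ a, ((θ a : ℝ) : ℂ) • D a)
    (fun θ θ' a b hab => affineFamily_smul_add_smul H₀ D θ θ' a b hab)
    (isHermitian_affineFamily hH₀ hD) hβ

/-- **Convexity of `θ ↦ log Z_β(H₀ + Σₐ θₐ Dₐ)`** (every real `β`; with `H₀ = 0` and `β = 1` this is the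
joint convexity of `c ↦ log tr exp(−Σₐ cₐ Dₐ)` in ALL coefficients, the inverse temperature included).
[cite: Israel1979, Thm. I.3.4] -/
theorem convexOn_log_partitionFn_coord [Nonempty n] (hH₀ : H₀.IsHermitian) (hD : ∀ a, (D a).IsHermitian)
    (β : ℝ) :
    ConvexOn ℝ Set.univ
      (fun θ : ι → ℝ => Real.log (partitionFn β (H₀ + ∑ a, ((θ a : ℝ) : ℂ) • D a)).re) :=
  convexOn_log_partitionFn_affine (H := fun θ : ι → ℝ => H₀ + ∑ a, ((θ a : ℝ) : ℂ) • D a)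
    (fun θ θ' a b hab => affineFamily_smul_add_smul H₀ D θ θ' a b hab)
    (isHermitian_affineFamily hH₀ hD) β

/-- **The tangent plane in slope form** (the multi-parameter Bogoliubov inequality, `β > 0`):
`F_β(θ) ≤ F_β(θ₀) + Σₐ (θₐ − θ₀ₐ) Re⟨Dₐ⟩_{β,θ₀}` — the slopes are the THERMAL EXPECTATIONS of the coupling
directions in the anchor's Gibbs state. [cite: Lieb1973, §V (5.2)–(5.4)] -/
theorem freeEnergy_coord_le_tangent [Nonempty n] (hH₀ : H₀.IsHermitian) (hD : ∀ a, (D a).IsHermitian)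
    {β : ℝ} (hβ : 0 < β) (θ θ₀ : ι → ℝ) :
    -(β⁻¹ * Real.log (partitionFn β (H₀ + ∑ a, ((θ a : ℝ) : ℂ) • D a)).re) ≤
      -(β⁻¹ * Real.log (partitionFn β (H₀ + ∑ a, ((θ₀ a : ℝ) : ℂ) • D a)).re) +
        ∑ a, (θ a - θ₀ a) * (gibbsState β (H₀ + ∑ a, ((θ₀ a : ℝ) : ℂ) • D a) (D a)).re := by
  have h := freeEnergy_affine_le_tangent (H := fun θ : ι → ℝ => H₀ + ∑ a, ((θ a : ℝ) : ℂ) • D a)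
    (isHermitian_affineFamily hH₀ hD) hβ θ₀ θ
  rwa [affineFamily_sub, re_gibbsState_sum_real_smul] at h

/-- **The lower tangent in slope form**: `F_β(θ₀) + Σₐ (θₐ − θ₀ₐ) Re⟨Dₐ⟩_{β,θ} ≤ F_β(θ)` (slopes read in the
TARGET's Gibbs state). [cite: Lieb1973, §V (5.2)–(5.4)] -/
theorem freeEnergy_coord_ge_tangent [Nonempty n] (hH₀ : H₀.IsHermitian) (hD : ∀ a, (D a).IsHermitian)
    {β : ℝ} (hβ : 0 < β) (θ θ₀ : ι → ℝ) :
    -(β⁻¹ * Real.log (partitionFn β (H₀ + ∑ a, ((θ₀ a : ℝ) : ℂ) • D a)).re) +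
        ∑ a, (θ a - θ₀ a) * (gibbsState β (H₀ + ∑ a, ((θ a : ℝ) : ℂ) • D a) (D a)).re ≤
      -(β⁻¹ * Real.log (partitionFn β (H₀ + ∑ a, ((θ a : ℝ) : ℂ) • D a)).re) := by
  have h := freeEnergy_affine_ge_tangent (H := fun θ : ι → ℝ => H₀ + ∑ a, ((θ a : ℝ) : ℂ) • D a)
    (isHermitian_affineFamily hH₀ hD) hβ θ₀ θ
  rwa [affineFamily_sub, re_gibbsState_sum_real_smul] at h

/-- Sign-split reading of a slope window: `lo ≤ s ≤ hi` gives `d·s ≤ max (d·lo) (d·hi)` for every real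
`d`. [folklore] -/
private theorem mul_le_max_mul_of_mem_Icc {s lo hi : ℝ} (hlo : lo ≤ s) (hhi : s ≤ hi) (d : ℝ) :
    d * s ≤ max (d * lo) (d * hi) := by
  rcases le_total 0 d with hd | hd
  · exact (mul_le_mul_of_nonneg_left hhi hd).trans (le_max_right _ _)
  · exact (mul_le_mul_of_nonpos_left hlo hd).trans (le_max_left _ _)

/-- **Certified reading of the tangent plane**: a certified free-energy CAP `F_β(θ₀) ≤ u₀` at the anchor and
certified slope WINDOWS `loₐ ≤ Re⟨Dₐ⟩_{β,θ₀} ≤ hiₐ` (e.g. from a Gibbs-state SDP relaxation) give, at EVERY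
coupling `θ`, `F_β(θ) ≤ u₀ + Σₐ max ((θₐ − θ₀ₐ) loₐ) ((θₐ − θ₀ₐ) hiₐ)` — interval arithmetic only.
[cite: Lieb1973, §V (5.2)–(5.4)] -/
theorem freeEnergy_coord_le_of_slopes_mem_Icc [Nonempty n] (hH₀ : H₀.IsHermitian)
    (hD : ∀ a, (D a).IsHermitian) {β : ℝ} (hβ : 0 < β) (θ θ₀ : ι → ℝ) {u₀ : ℝ} {lo hi : ι → ℝ}
    (hu₀ : -(β⁻¹ * Real.log (partitionFn β (H₀ + ∑ a, ((θ₀ a : ℝ) : ℂ) • D a)).re) ≤ u₀)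
    (hlo : ∀ a, lo a ≤ (gibbsState β (H₀ + ∑ a, ((θ₀ a : ℝ) : ℂ) • D a) (D a)).re)
    (hhi : ∀ a, (gibbsState β (H₀ + ∑ a, ((θ₀ a : ℝ) : ℂ) • D a) (D a)).re ≤ hi a) :
    -(β⁻¹ * Real.log (partitionFn β (H₀ + ∑ a, ((θ a : ℝ) : ℂ) • D a)).re) ≤
      u₀ + ∑ a, max ((θ a - θ₀ a) * lo a) ((θ a - θ₀ a) * hi a) := by
  refine (freeEnergy_coord_le_tangent hH₀ hD hβ θ θ₀).trans (add_le_add hu₀ ?_)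
  exact Finset.sum_le_sum fun a _ => mul_le_max_mul_of_mem_Icc (hlo a) (hhi a) _

/-- **Coordinate Lipschitz bound**: `|F_β(θ) − F_β(θ')| ≤ Σₐ |θₐ − θ'ₐ| ‖Dₐ‖` (`β > 0`).
[cite: Israel1979, Thm. I.3.4] -/
theorem abs_freeEnergy_coord_sub_le [Nonempty n] (hH₀ : H₀.IsHermitian) (hD : ∀ a, (D a).IsHermitian)
    {β : ℝ} (hβ : 0 < β) (θ θ' : ι → ℝ) :
    |-(β⁻¹ * Real.log (partitionFn β (H₀ + ∑ a, ((θ a : ℝ) : ℂ) • D a)).re) -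
        -(β⁻¹ * Real.log (partitionFn β (H₀ + ∑ a, ((θ' a : ℝ) : ℂ) • D a)).re)| ≤
      ∑ a, |θ a - θ' a| * ‖D a‖ := by
  have h := abs_freeEnergy_affine_sub_le (H := fun θ : ι → ℝ => H₀ + ∑ a, ((θ a : ℝ) : ℂ) • D a)
    (isHermitian_affineFamily hH₀ hD) hβ θ θ'
  rw [affineFamily_sub] at h
  refine h.trans ((norm_sum_le _ _).trans (le_of_eq (Finset.sum_congr rfl fun a _ => ?_)))
  rw [norm_smul, Complex.norm_real, Real.norm_eq_abs]

/-- **The coordinate Peierls–Bogoliubov bracket on a thermal expectation** (`β > 0`, step `h > 0` along the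
direction `a`, `eₐ = Pi.single a 1`):
`(F_β(θ + h eₐ) − F_β(θ))/h ≤ Re⟨Dₐ⟩_{β,θ} ≤ (F_β(θ) − F_β(θ − h eₐ))/h` — Lieb's (5.4): the thermal
expectation of a coupling direction is bracketed by the two one-sided free-energy difference quotients.
[cite: Lieb1973, §V (5.2)–(5.4)] -/
theorem freeEnergy_coord_slope_bracket [DecidableEq ι] [Nonempty n] (hH₀ : H₀.IsHermitian)
    (hD : ∀ a, (D a).IsHermitian) {β : ℝ} (hβ : 0 < β) (θ : ι → ℝ) (a : ι) {h : ℝ} (hh : 0 < h) :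
    (-(β⁻¹ * Real.log (partitionFn β (H₀ + ∑ c, (((θ + Pi.single a h : ι → ℝ) c : ℝ) : ℂ) • D c)).re) -
        -(β⁻¹ * Real.log (partitionFn β (H₀ + ∑ c, ((θ c : ℝ) : ℂ) • D c)).re)) / h ≤
      (gibbsState β (H₀ + ∑ c, ((θ c : ℝ) : ℂ) • D c) (D a)).re ∧
    (gibbsState β (H₀ + ∑ c, ((θ c : ℝ) : ℂ) • D c) (D a)).re ≤
      (-(β⁻¹ * Real.log (partitionFn β (H₀ + ∑ c, ((θ c : ℝ) : ℂ) • D c)).re) -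
        -(β⁻¹ * Real.log (partitionFn β (H₀ + ∑ c, (((θ - Pi.single a h : ι → ℝ) c : ℝ) : ℂ) • D c)).re)) / h := by
  have hslope : ∀ s : ℝ, ∑ c, ((θ + Pi.single a s : ι → ℝ) c - θ c) *
      (gibbsState β (H₀ + ∑ c, ((θ c : ℝ) : ℂ) • D c) (D c)).re =
        s * (gibbsState β (H₀ + ∑ c, ((θ c : ℝ) : ℂ) • D c) (D a)).re := by
    intro s
    simp only [Pi.add_apply, add_sub_cancel_left]
    rw [Finset.sum_eq_single a (fun c _ hc => by rw [Pi.single_eq_of_ne hc, zero_mul])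
      (fun ha => (ha (Finset.mem_univ a)).elim), Pi.single_eq_same]
  constructor
  · -- upper tangent at `θ` towards `θ + h eₐ`
    have h1 := freeEnergy_coord_le_tangent hH₀ hD hβ (θ + Pi.single a h) θ
    rw [hslope] at h1
    rw [div_le_iff₀ hh]
    linarith
  · -- upper tangent at `θ` towards `θ − h eₐ`
    have hsub : θ - Pi.single a h = θ + Pi.single a (-h) := by
      rw [sub_eq_add_neg, ← Pi.single_neg]
    have h1 := freeEnergy_coord_le_tangent hH₀ hD hβ (θ + Pi.single a (-h)) θ
    rw [hslope, ← hsub] at h1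
    rw [le_div_iff₀ hh]
    linarith

/-- **Certified thermal expectations from certified free-energy bounds at three couplings** (`β > 0`,
`h > 0`): a FLOOR `ℓ₊ ≤ F_β(θ + h eₐ)`, a CAP `F_β(θ) ≤ u₀` and a FLOOR `ℓ₋ ≤ F_β(θ − h eₐ)` give
`(ℓ₊ − u₀)/h ≤ Re⟨Dₐ⟩_{β,θ} ≤ (u₀ − ℓ₋)/h` — e.g. certified brackets on the thermal double occupancy
(`Dₐ = Σₓ nₓ↑nₓ↓`, coupling `U`) or on the particle number (`Dₐ = −N`, coupling `μ`) from certified free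
energies, the positive-temperature form of Griffiths' brackets. [cite: Lieb1973, §V (5.2)–(5.4)] -/
theorem re_gibbsState_coord_mem_Icc_of_bounds [DecidableEq ι] [Nonempty n] (hH₀ : H₀.IsHermitian)
    (hD : ∀ a, (D a).IsHermitian) {β : ℝ} (hβ : 0 < β) (θ : ι → ℝ) (a : ι) {h : ℝ} (hh : 0 < h)
    {ℓp u₀ ℓm : ℝ}
    (hℓp : ℓp ≤ -(β⁻¹ * Real.log (partitionFn β (H₀ + ∑ c, (((θ + Pi.single a h : ι → ℝ) c : ℝ) : ℂ) • D c)).re))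
    (hu₀ : -(β⁻¹ * Real.log (partitionFn β (H₀ + ∑ c, ((θ c : ℝ) : ℂ) • D c)).re) ≤ u₀)
    (hℓm : ℓm ≤ -(β⁻¹ * Real.log (partitionFn β (H₀ + ∑ c, (((θ - Pi.single a h : ι → ℝ) c : ℝ) : ℂ) • D c)).re)) :
    (gibbsState β (H₀ + ∑ c, ((θ c : ℝ) : ℂ) • D c) (D a)).re ∈ Set.Icc ((ℓp - u₀) / h) ((u₀ - ℓm) / h) := by
  obtain ⟨h1, h2⟩ := freeEnergy_coord_slope_bracket hH₀ hD hβ θ a hh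
  constructor
  · exact (div_le_div_of_nonneg_right (by linarith) hh.le).trans h1
  · exact h2.trans (div_le_div_of_nonneg_right (by linarith) hh.le)

end Coord


end Literature.MathematicalPhysics.QuantumLattice
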